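import Summits.AtomisticToContinuum.BoseEinsteinCondensation.Theses.BECSubharmonicContinuation
import Summits.AtomisticToContinuum.BoseEinsteinCondensation.Theorems.BECPeriodicReductionBoundaryTransferWeakResidual
import Summits.AtomisticToContinuum.BoseEinsteinCondensation.Theorems.BECThomsonPrinciplePeriodicToDirichletInnerFlatToBEC
import Literature.MathematicalPhysics.QuantumManyBody.SwapPurity

/-!
# STRATEGY-CENSUS sketch for `BoundaryTransferWeak` (stmt-AtomisticToContinuum-0827) — typed
# candidate pieces of every decomposition attempted, and the two checked facts the census rests on

crux-strategist (RESTATED re-audit, BC2 redirect) planner-cstrat-stmt-AtomisticToContinuum-0827-r1-0,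
2026-08-17. `X` = `BECSubharmonicContinuation.BoundaryTransferWeak` (∀ admissible `v`: torus BEC at
`v` at all small densities ⟹ Dirichlet `HasGroundStateBEC v ρ` at all small densities),
`S` = `_root_.BoseEinsteinCondensation`. Companion of `STRATEGY-CENSUS.md` (same crux directory) and
of `bc/Probes.lean` (S → X trivial; X → S fails; the landed one-piece reductions close by `exact`).

Contents (everything elaborates; the two `theorem`s are proved, no `sorry`):
* §1 `InnerCubeTransfer` — the "localise to the macroscopic inner cube" piece (census N3) — and the
  PROOF `boundaryTransferWeak_of_innerCubeTransfer : InnerCubeTransfer → X` (15 lines over the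
  landed inner-flat-mode lemmas): the piece implies the crux on its own, so N3 has one open piece,
  and that piece is `X` with its witnessing mode named (costume).
* §2 `BoxSliceRegularity` — the ONE-LAW half of the coupled-bath relocation bound (census N10/F1) —
  and the PROOF `flatness_of_boundedOscillation`: a nonnegative function whose oscillation over a
  set `C` is bounded by `e^M` has Bhattacharyya flatness `(∫_C f)² ≥ e^{-M}·|C|·∫_C f²`. This is the
  coupled-bath card's lemma L1 with the torus slice replaced by the constant `1`: the box half of
  any in-measure slice-comparison transfer already yields inner-cube flatness `≥ e^{-M}` of the
  Dirichlet slices, hence `B`, with the torus antecedent `A` idle.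
* §3 the Dirichlet-native signatures `SubharmonicCoherenceD`, `HealingScaleDeficitD`,
  `HarmonicMinorantD`, `BallCriterionD` (recommendation R-D of the census): the route's own
  mechanism typed in the box with the zero-extended autocorrelation `G_D`, showing that
  `BECSubharmonicContinuation` never needed the transfer.
* §4 (appendix) the declarations `crux_iff`, `d2_assembly`, `dirichletBEC_of_innerFlatBECAt`,
  `d9_assembly` (+ `TorusBEC`, `DirichletBEC`, `CondensedToBECAt`, `InnerFlatBECAt`, `PurityFloorAt`)
  cited by the unit census at census_path (`STRATEGY-CENSUS.md`, sibling instance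
  BECNewtonPolicyIteration), re-typed and PROVED here so that census and sketch agree (a folder
  name-collision between concurrent instances of this seat had lost the sibling's file).

Authorship: §0–§3 instance BECSubharmonicContinuation (supplement
`REAUDIT-SUPPLEMENT-SubharmonicContinuation.md`); §4 statements after the sibling's census prose.
-/

noncomputable section

open MeasureTheory Filter
open scoped ENNReal NNReal ComplexConjugate

namespace Summit.AtomisticToContinuum.BoseEinsteinCondensation.Cruxes.BoundaryTransferWeak.Census

open Literature.MathematicalPhysics.QuantumManyBody.BoseGas
open Summit.AtomisticToContinuum.BoseEinsteinCondensation

/-! ## §0 Vocabulary (explicit terms, as in the landed `stub_innerFlatToBEC`) -/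

/-- The inner cube `(θL, L-θL)³`. [folklore] -/
def innerCube (θ L : ℝ) : Set Space :=
  {x : Space | ∀ t, x t ∈ Set.Ioo (θ * L) (L - θ * L)}

/-- Its normalised flat mode. [folklore] -/
def innerFlatMode (θ L : ℝ) : Space → ℂ :=
  Set.indicator {x : Space | ∀ t, x t ∈ Set.Ioo (θ * L) (L - θ * L)}
    (fun _ => ((Real.sqrt (((1 - 2 * θ) * L) ^ 3))⁻¹ : ℂ))

/-! ## §1 Census N3 — localisation to the macroscopic inner cube is free on the conclusion side,
so the "local transfer" piece is the crux with a named mode -/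

/-- **Candidate piece (N3) `InnerCubeTransfer`**: torus BEC at `(v, ρ, c)` (the body of `X`'s
antecedent, `TorusBECAt`) implies flat-mode BEC of the Dirichlet `δ`-near-minimisers on the INNER
cube `(L/4, 3L/4)³`, eventually in `N`, for all small `ρ`. [folklore] -/
def InnerCubeTransfer : Prop :=
  ∀ v : ℝ → ℝ≥0∞, IsRepulsiveFiniteRange v → ∃ ρ₀ : ℝ, 0 < ρ₀ ∧ ∀ ρ : ℝ, 0 < ρ → ρ < ρ₀ →
    ∀ c : ℝ, 0 < c → c ≤ 1 → RewardPaysTheWall.TorusBECAt v ρ c →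
      ∃ κ : ℝ, 0 < κ ∧ ∀ᶠ N : ℕ in atTop, ∃ δ : ℝ≥0∞, 0 < δ ∧
        ∀ Ψ : TrialState N (sideLength ρ N),
          energy v Ψ ≤ groundStateEnergy v N (sideLength ρ N) + δ →
            ENNReal.ofReal (κ * N) ≤ occupation N (innerFlatMode (1 / 4) (sideLength ρ N)) Ψ.ψ

/-- **N3 has one open piece and it is the crux reworded**: `InnerCubeTransfer → X`, proved over
the landed inner-flat-mode lemmas (`TorusInTheBox.aestronglyMeasurable_innerFlatMode`,
`lintegral_innerFlatMode_sq`) — no gluing lemma is needed because `HasGroundStateBEC` asks for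
SOME macroscopically occupied mode and a mode living in the inner cube qualifies. [folklore] -/
theorem boundaryTransferWeak_of_innerCubeTransfer (hT : InnerCubeTransfer) :
    Theses.BECSubharmonicContinuation.BoundaryTransferWeak := by
  intro v hv hA
  obtain ⟨ρA, hρA, HA⟩ := hA
  obtain ⟨ρ₀, hρ₀, H⟩ := hT v hv
  refine ⟨min ρA ρ₀, lt_min hρA hρ₀, fun ρ hρ hlt => ?_⟩
  obtain ⟨c, hc, hTor⟩ := HA ρ hρ (hlt.trans_le (min_le_left _ _))
  have hTor' : RewardPaysTheWall.TorusBECAt v ρ (min c 1) :=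
    RewardPaysTheWall.TorusBECAt.mono (min_le_left c 1) hTor
  obtain ⟨κ, hκ, hev⟩ := H ρ hρ (hlt.trans_le (min_le_right _ _)) (min c 1)
    (lt_min hc one_pos) (min_le_right c 1) hTor'
  refine ⟨κ, hκ, ?_⟩
  filter_upwards [hev, eventually_gt_atTop 0] with N hN hNpos
  obtain ⟨δ, hδ, hΨ⟩ := hN
  have hL : 0 < sideLength ρ N := by
    unfold sideLength
    exact Real.rpow_pos_of_pos (div_pos (Nat.cast_pos.mpr hNpos) hρ) _
  have hM : 0 < (1 - 2 * (1 / 4 : ℝ)) * sideLength ρ N := mul_pos (by norm_num) hL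
  exact le_condensateNumber v hδ fun Ψ hE =>
    (hΨ Ψ hE).trans (occupation_le_maxOccupation _
      (TorusInTheBox.aestronglyMeasurable_innerFlatMode _ _)
      (TorusInTheBox.lintegral_innerFlatMode_sq hM))

/-! ## §2 Census N10 / finding (F1) — the one-law half of the coupled-bath relocation bound -/

/-- A slice `f ≥ 0` on the cube `C` is **`(ε, M)`-regular**: off an exceptional set `S ⊆ C` of
relative volume `≤ ε` carrying `≤ ε` of its mass, its oscillation is bounded by `e^M`. (The box
factor of the coupled-bath card's good event, with the torus slice deleted.) [folklore] -/
def RegularSlice (C : Set Space) (ε M : ℝ) (f : Space → ℝ) : Prop :=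
  ∃ S : Set Space, S ⊆ C ∧ MeasurableSet S ∧ volume S ≤ ENNReal.ofReal ε * volume C ∧
    (∫⁻ x in S, ENNReal.ofReal (f x ^ 2)) ≤ ENNReal.ofReal ε * ∫⁻ x in C, ENNReal.ofReal (f x ^ 2) ∧
    ∀ x ∈ C \ S, ∀ y ∈ C \ S, f x ≤ Real.exp M * f y

open Classical in
/-- **Candidate piece (N10, one-law form) `BoxSliceRegularity`**: for the nonnegative Dirichlet
minimiser `Ψ` of `N = n+1` particles at density `ρ`, for all but an `η`-fraction (in `Ψ²`-mass)
of the baths `Y`, the slice `x ↦ Ψ(x :: Y)` is `(ε, M)`-regular on the inner cube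
`(L/4, 3L/4)³`, with `M = M(v, ρ, ε, η)` independent of `N`. It is the `Q`-half of the coupled
relocation bound (take the coupling's good event and forget the torus configuration), and by
`flatness_of_boundedOscillation` it ALONE gives inner-cube flat occupation
`≥ (Q(x₁ ∈ C) − η)·e^{-M}(1 − O(ε))·N`, i.e. the conjunct's body via `stub_innerFlatToBEC` —
the torus antecedent is idle. [folklore] -/
def BoxSliceRegularity : Prop :=
  ∀ v : ℝ → ℝ≥0∞, IsRepulsiveFiniteRange v → ∃ ρ₁ : ℝ, 0 < ρ₁ ∧ ∀ ρ : ℝ, 0 < ρ → ρ < ρ₁ →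
    ∀ ε : ℝ, 0 < ε → ∀ η : ℝ, 0 < η → ∃ M : ℝ, ∀ᶠ n : ℕ in atTop,
      ∀ Ψ : TrialState (n + 1) (sideLength ρ (n + 1)),
        (∀ X, Ψ.ψ X = ‖Ψ.ψ X‖) →
        energy v Ψ = groundStateEnergy v (n + 1) (sideLength ρ (n + 1)) →
          ∫⁻ Y : Config n,
              Set.indicator {Y : Config n | ¬ RegularSlice (innerCube (1 / 4) (sideLength ρ (n + 1)))
                  ε M (fun x => ‖Ψ.ψ (Matrix.vecCons x Y)‖)} (fun _ => (1 : ℝ≥0∞)) Y *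
                (∫⁻ x : Space, (‖Ψ.ψ (Matrix.vecCons x Y)‖₊ : ℝ≥0∞) ^ 2) ≤
            ENNReal.ofReal η

/-- **(F1) Bounded oscillation alone gives Bhattacharyya flatness.** If `f ≥ 0` satisfies
`f x ≤ e^M f y` for all `x, y ∈ C`, then `|C| · ∫_C f² ≤ e^M (∫_C f)²`, i.e. the flatness
`BC_C(f)² = (∫_C f)²/(|C|∫_C f²) ≥ e^{-M}` — the multiplicative flatness transfer of the
coupled-bath card with the torus slice `g ≡ 1`. Proof: `f(y)² ≤ e^M f(x) f(y)`, integrate in `x`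
then in `y` (Tonelli is not even needed). [folklore] -/
theorem flatness_of_boundedOscillation {C : Set Space} {f : Space → ℝ≥0∞} (hf : Measurable f)
    {M : ℝ} (h : ∀ x ∈ C, ∀ y ∈ C, f x ≤ ENNReal.ofReal (Real.exp M) * f y) :
    volume C * ∫⁻ y in C, f y ^ 2 ≤
      ENNReal.ofReal (Real.exp M) * (∫⁻ x in C, f x) * ∫⁻ y in C, f y := by
  have key : ∀ y ∈ C, volume C * f y ^ 2 ≤
      ENNReal.ofReal (Real.exp M) * (∫⁻ x in C, f x) * f y := by
    intro y hy
    calc volume C * f y ^ 2 = ∫⁻ _ in C, f y * f y := by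
          rw [setLIntegral_const, sq, mul_comm]
      _ ≤ ∫⁻ x in C, ENNReal.ofReal (Real.exp M) * f x * f y :=
          setLIntegral_mono ((hf.const_mul _).mul_const _) fun x hx => by
            gcongr
            exact h y hy x hx
      _ = ENNReal.ofReal (Real.exp M) * (∫⁻ x in C, f x) * f y := by
          rw [lintegral_mul_const _ (hf.const_mul _), lintegral_const_mul _ hf]
  calc volume C * ∫⁻ y in C, f y ^ 2 = ∫⁻ y in C, volume C * f y ^ 2 :=
        (lintegral_const_mul _ (hf.pow_const 2)).symm
    _ ≤ ∫⁻ y in C, ENNReal.ofReal (Real.exp M) * (∫⁻ x in C, f x) * f y :=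
        setLIntegral_mono (hf.const_mul _) key
    _ = ENNReal.ofReal (Real.exp M) * (∫⁻ x in C, f x) * ∫⁻ y in C, f y :=
        lintegral_const_mul _ hf

/-! ## §3 Recommendation R-D — the route's mechanism typed natively in the Dirichlet box

`G_D(N,L,Ψ,i,y) = Re ∫ conj Ψ(X^{i→x_i+y}) Ψ(X) dX` over all of `(ℝ³)^N` (the Dirichlet trial state
vanishes off the box, so this is the autocorrelation of the zero-extended state: positive-definite
on `ℝ³`, `G_D(0) = 1`, supported in `|y|_∞ < L`), `H_D = -ΔG_D` the kinetic coherence. The torus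
items `SubharmonicCoherence` / `HealingScaleDeficit` / `HarmonicMinorant` / `BallCriterion` of
`BECSubharmonicContinuation` transcribe verbatim; only `BallCriterion` changes shape (continuous
momenta below `2π/L` are absorbed by the time–bandwidth trace bound `tr(1_Λ P_{|k|≤2π/L} 1_Λ) = 4π/3`,
so the conclusion is in `maxOccupation`, which is all `HasGroundStateBEC` asks). The energy input
`E₀^D ≤ 4πρa(1+C(ρa³)^{1/3})N` eventually is the PROVED `eventually_groundStateEnergy_le_dyson`;
the `a = 0` case is the PROVED `hasGroundStateBEC_zero`. -/

/-- Dirichlet-native S1 (signature only; constants as on the torus). [folklore] -/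
def SubharmonicCoherenceD : Prop :=
  let H : (N : ℕ) → (L : ℝ) → TrialState N L → Fin N → Space → ℝ := fun N _ Ψ i y =>
    (∑ k : Fin 3, ∫ X : Config N,
      conj (fderiv ℝ Ψ.ψ (Function.update X i (X i + y)) (Pi.single i (EuclideanSpace.single k (1 : ℝ)))) *
        fderiv ℝ Ψ.ψ X (Pi.single i (EuclideanSpace.single k (1 : ℝ)))).re
  let ξ : (ℝ → ℝ≥0∞) → ℝ → ℝ := fun v ρ =>
    (Real.sqrt (8 * Real.pi * ρ * (scatteringLength v).toReal))⁻¹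
  ∀ v : ℝ → ℝ≥0∞, IsRepulsiveFiniteRange v → scatteringLength v ≠ ⊤ → 0 < scatteringLength v →
    ∃ M : ℝ, 0 < M ∧ ∃ ρ₀ : ℝ, 0 < ρ₀ ∧ ∀ ρ : ℝ, 0 < ρ → ρ < ρ₀ → ∀ᶠ N : ℕ in atTop,
      ∃ δ : ℝ≥0∞, 0 < δ ∧ ∀ Ψ : TrialState N (sideLength ρ N),
        energy v Ψ ≤ groundStateEnergy v N (sideLength ρ N) + δ → ∀ i : Fin N,
          (4 * Real.pi)⁻¹ * (∫ y in {y : Space | M * ξ v ρ ≤ ‖y‖},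
            max (H N (sideLength ρ N) Ψ i y) 0 / ‖y‖) ≤ 1 / 8

/-- Dirichlet-native S2 (signature only). [folklore] -/
def HealingScaleDeficitD : Prop :=
  let G : (N : ℕ) → (L : ℝ) → TrialState N L → Fin N → Space → ℝ := fun N _ Ψ i y =>
    (∫ X : Config N, conj (Ψ.ψ (Function.update X i (X i + y))) * Ψ.ψ X).re
  let ξ : (ℝ → ℝ≥0∞) → ℝ → ℝ := fun v ρ =>
    (Real.sqrt (8 * Real.pi * ρ * (scatteringLength v).toReal))⁻¹
  ∀ v : ℝ → ℝ≥0∞, IsRepulsiveFiniteRange v → scatteringLength v ≠ ⊤ → 0 < scatteringLength v →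
    ∀ M : ℝ, 0 < M → ∀ ε : ℝ, 0 < ε → ∃ ρ₀ : ℝ, 0 < ρ₀ ∧ ∀ ρ : ℝ, 0 < ρ → ρ < ρ₀ →
      ∀ᶠ N : ℕ in atTop, ∃ δ : ℝ≥0∞, 0 < δ ∧ ∀ Ψ : TrialState N (sideLength ρ N),
        energy v Ψ ≤ groundStateEnergy v N (sideLength ρ N) + δ → ∀ i : Fin N,
          1 - ε ≤ (M * ξ v ρ)⁻¹ ^ 3 *
            ∫ y : Space, (∏ k : Fin 3, max (1 - |y k| / (M * ξ v ρ)) 0) * G N (sideLength ρ N) Ψ i y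

/-- Dirichlet-native continuation lemma (signature only; pure Fourier analysis on `ℝ³`). [folklore] -/
def HarmonicMinorantD : Prop :=
  let G : (N : ℕ) → (L : ℝ) → TrialState N L → Fin N → Space → ℝ := fun N _ Ψ i y =>
    (∫ X : Config N, conj (Ψ.ψ (Function.update X i (X i + y))) * Ψ.ψ X).re
  let H : (N : ℕ) → (L : ℝ) → TrialState N L → Fin N → Space → ℝ := fun N _ Ψ i y =>
    (∑ k : Fin 3, ∫ X : Config N,
      conj (fderiv ℝ Ψ.ψ (Function.update X i (X i + y)) (Pi.single i (EuclideanSpace.single k (1 : ℝ)))) *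
        fderiv ℝ Ψ.ψ X (Pi.single i (EuclideanSpace.single k (1 : ℝ)))).re
  ∀ (N : ℕ) (L : ℝ), 0 < L → ∀ (Ψ : TrialState N L) (i : Fin N) (R S : ℝ), 0 < R → R ≤ S →
    1 - (⨍ y in Metric.ball (0 : Space) S, G N L Ψ i y) ≤
      (4 * Real.pi)⁻¹ * (∫ y in Metric.ball (0 : Space) R, H N L Ψ i y / ‖y‖) +
        H N L Ψ i 0 * R ^ 3 / S +
        (4 * Real.pi)⁻¹ * (∫ y in {y : Space | R ≤ ‖y‖ ∧ ‖y‖ ≤ S}, max (H N L Ψ i y) 0 / ‖y‖)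

/-- Dirichlet-native ball criterion in `λ_max` form (signature only; the constants `0.41 ≥
sup_{s ≥ π} 3(sin s − s cos s)/s³` and `2.5 ≥ 0.59 · 4π/3` are indicative). [folklore] -/
def BallCriterionD : Prop :=
  let G : (N : ℕ) → (L : ℝ) → TrialState N L → Fin N → Space → ℝ := fun N _ Ψ i y =>
    (∫ X : Config N, conj (Ψ.ψ (Function.update X i (X i + y))) * Ψ.ψ X).re
  ∀ (N : ℕ) (L σ : ℝ), 0 < L → ∀ (Ψ : TrialState N L) (i : Fin N),
    σ ≤ (⨍ y in Metric.ball (0 : Space) (L / 2), G N L Ψ i y) →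
      ENNReal.ofReal ((σ - 0.41) / 2.5 * N) ≤ maxOccupation N Ψ.ψ

end Summit.AtomisticToContinuum.BoseEinsteinCondensation.Cruxes.BoundaryTransferWeak.Census

/-! ## §4 Appendix — the four declarations cited by the unit census at census_path
(`STRATEGY-CENSUS.md`, instance BECNewtonPolicyIteration: `Census.crux_iff`, `Census.d2_assembly`,
`Census.d9_assembly`, `Census.dirichletBEC_of_innerFlatBECAt`), re-typed here by the
SubharmonicContinuation instance from that census's prose after a folder name-collision lost the
sibling's `Sketch.lean`; statements follow its D1/D2/D9 entries. -/

namespace Summit.AtomisticToContinuum.BoseEinsteinCondensation.Cruxes.BoundaryTransferWeak.Census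

open MeasureTheory Filter
open scoped ENNReal NNReal
open Literature.MathematicalPhysics.QuantumManyBody.BoseGas
open Summit.AtomisticToContinuum.BoseEinsteinCondensation

/-- `A(v)`: torus BEC at `v` at all small densities (the crux's antecedent at `v`). [folklore] -/
def TorusBEC (v : ℝ → ℝ≥0∞) : Prop :=
  ∃ ρ₀ : ℝ, 0 < ρ₀ ∧ ∀ ρ : ℝ, 0 < ρ → ρ < ρ₀ → ∃ c : ℝ, 0 < c ∧ RewardPaysTheWall.TorusBECAt v ρ c

/-- `B(v)`: the Statement's body at `v`. [folklore] -/
def DirichletBEC (v : ℝ → ℝ≥0∞) : Prop :=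
  ∃ ρ₀ : ℝ, 0 < ρ₀ ∧ ∀ ρ : ℝ, 0 < ρ → ρ < ρ₀ → HasGroundStateBEC v ρ

/-- **Frame (census §0): `BoundaryTransferWeak ↔ ∀ v adm, A(v) → B(v)`**, by `Iff.rfl`. [folklore] -/
theorem crux_iff :
    Theses.BECSubharmonicContinuation.BoundaryTransferWeak ↔
      ∀ v : ℝ → ℝ≥0∞, IsRepulsiveFiniteRange v → TorusBEC v → DirichletBEC v :=
  Iff.rfl

/-- `CondensedToBECAt v` (census D2): "flat-condensed competitors `θN` above `E₀^D` for every `θ`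
suffice for ground-state BEC", at one `v` (A-free; verbatim the hypothesis of the landed
`RewardPaysTheWall.boundaryTransferAt_of_condensedToBECAt`). [folklore] -/
def CondensedToBECAt (v : ℝ → ℝ≥0∞) : Prop :=
  ∃ ρ₄ : ℝ, 0 < ρ₄ ∧ ∀ ρ : ℝ, 0 < ρ → ρ < ρ₄ → ∀ c : ℝ, 0 < c → c ≤ 1 →
    (∀ θ : ℝ, 0 < θ → ∀ᶠ N : ℕ in atTop, ∃ Ψ : TrialState N (sideLength ρ N),
      energy v Ψ ≤ groundStateEnergy v N (sideLength ρ N) + ENNReal.ofReal (θ * N) ∧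
        ENNReal.ofReal ((c - θ) * N) ≤ occupation N (boxConstantMode (sideLength ρ N)) Ψ.ψ) →
    HasGroundStateBEC v ρ

/-- **Census D2 — the landed `k = 1` reduction at `v`**: `CondensedToBECAt v → (A(v) → B(v))` is
the landed p96138 theorem (so the open piece closes the crux at `v` by `exact`). [folklore] -/
theorem d2_assembly {v : ℝ → ℝ≥0∞} (hv : IsRepulsiveFiniteRange v) (h : CondensedToBECAt v) :
    TorusBEC v → DirichletBEC v :=
  fun hA => RewardPaysTheWall.boundaryTransferAt_of_condensedToBECAt hv h hA

/-- `InnerFlatBECAt v` (census D1's intermediate target): all Dirichlet `δ`-near-minimisers are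
inner-flat condensed, eventually in `N`, at all small densities. [folklore] -/
def InnerFlatBECAt (v : ℝ → ℝ≥0∞) : Prop :=
  ∃ ρ₀ : ℝ, 0 < ρ₀ ∧ ∀ ρ : ℝ, 0 < ρ → ρ < ρ₀ → ∃ θ : ℝ, 0 < θ ∧ θ < 1 / 2 ∧ ∃ c : ℝ, 0 < c ∧
    ∀ᶠ N : ℕ in atTop, ∃ δ : ℝ≥0∞, 0 < δ ∧ ∀ Ψ : TrialState N (sideLength ρ N),
      energy v Ψ ≤ groundStateEnergy v N (sideLength ρ N) + δ →
        ENNReal.ofReal (c * N) ≤ occupation N (innerFlatMode θ (sideLength ρ N)) Ψ.ψ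

/-- **Census D1 glue — `InnerFlatBECAt v → B(v)`** (pattern of the landed `stub_innerFlatToBEC`,
p107171, pointwise in `v`). [folklore] -/
theorem dirichletBEC_of_innerFlatBECAt {v : ℝ → ℝ≥0∞} (h : InnerFlatBECAt v) : DirichletBEC v := by
  obtain ⟨ρ₀, hρ₀, H⟩ := h
  refine ⟨ρ₀, hρ₀, fun ρ hρ hlt => ?_⟩
  obtain ⟨θ, _hθ, hθhalf, c, hc, hev⟩ := H ρ hρ hlt
  refine ⟨c, hc, ?_⟩
  filter_upwards [hev, eventually_gt_atTop 0] with N hN hNpos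
  obtain ⟨δ, hδ, hΨ⟩ := hN
  have hL : 0 < sideLength ρ N := by
    unfold sideLength
    exact Real.rpow_pos_of_pos (div_pos (Nat.cast_pos.mpr hNpos) hρ) _
  have hM : 0 < (1 - 2 * θ) * sideLength ρ N := mul_pos (by linarith) hL
  exact le_condensateNumber v hδ fun Ψ hE =>
    (hΨ Ψ hE).trans (occupation_le_maxOccupation _
      (TorusInTheBox.aestronglyMeasurable_innerFlatMode _ _)
      (TorusInTheBox.lintegral_innerFlatMode_sq hM))

/-- `PurityFloorAt v` (census D9): torus BEC at `v` gives a swap-purity floor (`tr γ²/N² ≥ c`) for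
the Dirichlet `δ`-near-minimisers, eventually in `N = n + 1`, at all small densities. [folklore] -/
def PurityFloorAt (v : ℝ → ℝ≥0∞) : Prop :=
  TorusBEC v → ∃ ρ₀ : ℝ, 0 < ρ₀ ∧ ∀ ρ : ℝ, 0 < ρ → ρ < ρ₀ → ∃ c : ℝ, 0 < c ∧
    ∀ᶠ n : ℕ in atTop, ∃ δ : ℝ≥0∞, 0 < δ ∧ ∀ Ψ : TrialState (n + 1) (sideLength ρ (n + 1)),
      energy v Ψ ≤ groundStateEnergy v (n + 1) (sideLength ρ (n + 1)) + δ →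
        ENNReal.ofReal c ≤ swapPurity n Ψ.ψ

/-- **Census D9 — the mode-free criterion split has `k_open = 1`**: `PurityFloorAt v → (A(v) → B(v))`
through the TREE theorem `N · swapPurity ≤ λ_max(γ_Ψ)`
(`TrialState.succ_mul_swapPurity_le_maxOccupation`). [folklore] -/
theorem d9_assembly {v : ℝ → ℝ≥0∞} (h : PurityFloorAt v) : TorusBEC v → DirichletBEC v := by
  intro hA
  obtain ⟨ρ₀, hρ₀, H⟩ := h hA
  refine ⟨ρ₀, hρ₀, fun ρ hρ hlt => ?_⟩
  obtain ⟨c, hc, hev⟩ := H ρ hρ hlt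
  refine ⟨c, hc, ?_⟩
  -- shift the index `n ↦ n + 1`
  obtain ⟨n₀, hn₀⟩ := Filter.eventually_atTop.1 hev
  refine Filter.eventually_atTop.2 ⟨n₀ + 1, fun N hN => ?_⟩
  obtain ⟨n, rfl⟩ : ∃ n, N = n + 1 := ⟨N - 1, by omega⟩
  obtain ⟨δ, hδ, hΨ⟩ := hn₀ n (by omega)
  refine le_condensateNumber v hδ fun Ψ hE => ?_
  calc ENNReal.ofReal (c * (n + 1 : ℕ))
      = ((n + 1 : ℕ) : ℝ≥0∞) * ENNReal.ofReal c := by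
        rw [mul_comm, ENNReal.ofReal_mul (by positivity), ENNReal.ofReal_natCast]
    _ ≤ ((n + 1 : ℕ) : ℝ≥0∞) * swapPurity n Ψ.ψ := by gcongr; exact hΨ Ψ hE
    _ ≤ maxOccupation (n + 1) Ψ.ψ := Ψ.succ_mul_swapPurity_le_maxOccupation

end Summit.AtomisticToContinuum.BoseEinsteinCondensation.Cruxes.BoundaryTransferWeak.Census

end
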